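/-
COR-CM (cell pub-hodgecm2) — ι₁ ∕ Id CHAIN (WORLD = C), module I3 of the ASSEMBLER's table (`HOME/d2bridge/iota1/TABLE.md` v1.2, HOME/INBOX l.12682):
the μ-UNIFORM WEIL CARRIERS OF RECORD over the UNTWISTED §4.2 datum `sec42DataIdOf` (instlevel-a I0∕I1), by FIELD TRANSPORT (cmside-b's
C-DEPENDENCE-CENSUS §B(2)).  Seat rekey-l1-cmside-a g1 (prover-pub-hodgecm2-rekey-l1-cmside-a-g1-0), 2026-08-23∕24.
KERNEL only: ONE data `def` (a record re-assembled from the fields of ✔ `Model.uniformOmegaRep`) + `rfl` theorems; nothing landed is edited;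
no named fact beyond `h : exists_recordSystem` (the datum's own).  HC_CM is NOT proved; «Δ2 BRIDGE CLOSED» is NOT claimed.
-/
import Summits.HodgeConjecture.CorCM.B01.Transposition.Item6UniformOmegaRep
import Summits.HodgeConjecture.CorCM.B01.Transposition.HComp.Sec42DataIdOf
import HarnessLib

set_option autoImplicit false

/-!
# ι₁ ∕ Id chain, I3: `Model.uniformOmegaRepId` — the μ-uniform Weil carriers over the untwisted datum `ℭ₁ := sec42DataIdOf …`

`Model.uniformOmegaRep h F ι₁ V Φ e dV hdV hdV0 ιV δ′ r : UniformOmega (sec42DataOf h isoOf F ι₁ V Φ)` (✔ `Item6UniformOmegaRep.lean`) reads the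
§4.2 datum ONLY through `C.G = ↥V.adelicFin` (the `rho` field); the untwisted datum `ℭ₁ := sec42DataIdOf h isoOf F ι₁ V Φ` (I1) has the SAME
group literally (`honestP5Id … |>.G := ↥V.adelicFin`, I0 :69).  So the carriers of record transfer to `ℭ₁` by FIELD TRANSPORT — the five data
fields of `uniformOmegaRepId` ARE the fields of `uniformOmegaRep` (same terms, no copy of the ω-telescope):

* `Model.uniformOmegaRepId … : UniformOmega (sec42DataIdOf h isoOf F ι₁ V Φ)` (`𝕌₁`), with `uniformOmegaRepId_Eps ∕ _epsOf ∕ _Chi ∕ _omega ∕ _rho`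
  (`rfl`: `𝕌₁.X = 𝕌.X` field by field);
* THE PAY-OFF FOR THE Ω-SIDE OF THE CHAIN (census §B, the «R-a» test, run here once and for all): for ANY tails `t₁ : RestTail ℭ₁ μ hμ` and
  `t : RestTail ℭ μ hμ` at the same `(μ, hμ)` — `admIndex_rest_uniformOmegaRepId_eq` : `(toThm418Data ℭ₁ (𝕌₁.rest t₁)).AdmIndex = (toThm418Data ℭ (𝕌.rest t)).AdmIndex`,
  `omegaAt_rest_uniformOmegaRepId_eq`, `rhoAt_rest_uniformOmegaRepId_eq` (`rfl` on every index), `cmType_rest_uniformOmegaRepId_eq`,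
  and `prop413Data_uniformOmegaRepId_eq : 𝕌₁.prop413Data H = 𝕌.prop413Data H` (`rfl`) — so the (b) Ω-slot theorems (✔ `OmegaPinAtLiuIndexOfRecord`
  and the three files under it), the (b′) non-vanishing `nontrivial_omegaAt_…`, and the displayed cites `h413 ∕ h411 ∕ hsep` at `𝕌₁` are the SAME
  propositions as at `𝕌` — I9∕I10 transport them by `exact`, no twin of the ≈ 1 010-line Ω-pin chain (TABLE v1.2).
What does NOT transfer (class T of the census): anything reading the TAIL's `Obj ∕ Aμ ∕ Ω ∕ rhoΩ ∕ res` (hLiu′, `Map43RationalData`, `HcmPieces`) —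
rows I6∕I7∕I8; the Id tail `𝔱₁ := restTailOne (AlgHom.id ℚ F) ι₁ hμ hw (Carriers.ofPolDR …) ((heckeTranslatesFamilyIdOf … h6).rhoΩOne …)` is
generic `restTailOne` over I2's translates (no declaration needed here; a §3 with the `𝔱₁`-level `hmultD` twin follows when I2 is on the desk).

References: [Liu2021] Y. Liu, arXiv:2102.11518, Def. 4.11 (ll. 2083–2097), Def. 4.12 (ll. 2102–2108), Prop. 4.13 (ll. 2113–2119), Def. 4.16, Thm. 4.18;
[GelbartRogawski1991] §3.1 Prop. 3.1.1.  Tree: `B01/Transposition/Item6UniformOmegaRep.lean`, `B01/Transposition/HComp/{HonestP5Id,Sec42DataIdOf}.lean` (I0∕I1),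
`Liu2021/AppendixC/Prop413DataOfTower.lean` (`UniformOmega`, `.rest`, `.prop413Data`), `Liu2021/AppendixC/Glue.lean` (`toThm418Data`).
-/

noncomputable section

open scoped TensorProduct
open NumberField
open Literature.AlgebraicGeometry.Motives
open Literature.AlgebraicGeometry.ShimuraVarieties.UnitaryCanonicalModel
open Literature.NumberTheory.Automorphic
open Literature.NumberTheory.Automorphic.IdeleClassGroup
open Literature.NumberTheory.Automorphic.Liu2021
open Literature.NumberTheory.Automorphic.Liu2021.AppendixC
open Literature.NumberTheory.Automorphic.Liu2021.AppendixC.RestOne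
open Literature.NumberTheory.Automorphic.Liu2021.Def411WeilCarriers (Rep omegaAtLine rhoAtLine)
open Literature.NumberTheory.GelbartRogawski1991 Literature.NumberTheory.GelbartRogawski1991.UnitaryDualPair
open Literature.NumberTheory.GelbartRogawski1991.UnitaryDualPair.WeilCoinv
open Literature.NumberTheory.Weil1964 Literature.RepresentationTheory
open Literature.RepresentationTheory.Liu2021
open Summit.HodgeConjecture.CorCM.Transposition

namespace Summit.HodgeConjecture.CorCM.Model

section Frame

/- Binders are EXPLICIT on every declaration (no section `variable` carrying the named fact `h`), in the SAME ORDER as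
✔ `Model.uniformOmegaRep h F ι₁ V Φ e dV hdV hdV0 ιV δ' r`, so that consumers flip ONE token. -/

/-! ## §1 The carriers of record over `ℭ₁`, by field transport -/

/-- **`𝕌₁` — the μ-UNIFORM Weil carriers of the model at `(δ′, r)` over the UNTWISTED §4.2 datum `sec42DataIdOf …`** ([Liu2021] Def. 4.11 ∕ 4.12:
`Eps`, `epsOf … δ′`, `Chi`, `ω(μ,ε,χ)` with its `𝔾(𝔸_F^∞)`-action through `ιV`), BY FIELD TRANSPORT from ✔ `Model.uniformOmegaRep` — the five data
fields are the same terms (the datum enters only through `C.G = ↥V.adelicFin`, literal on both sides).  Nothing asserted.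
[cite: Liu2021, Def. 4.11 (ll. 2083–2097), Def. 4.12 (ll. 2102–2108)] [cite: GelbartRogawski1991, §3.1 Prop. 3.1.1 p. 455 L1–3] -/
def uniformOmegaRepId (h : exists_recordSystem) (F : CMField) [IsGalois ℚ F]
    (ι₁ : F →+* ℂ) (V : HermSpace3 F ι₁) (Φ : CMType F) {n : ℕ} (e : Fin 3 × Fin 1 ≃ Fin n) (dV : Fin 3 → F)
    (hdV : ∀ i, IsCMField.complexConj F (dV i) = dV i) (hdV0 : ∀ i, dV i ≠ 0)
    (ιV : (sec42DataIdOf h isoOf F ι₁ V Φ).G →*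
      UnitaryGroup.finAdelic ↥(maximalRealSubfield F) F (IsCMField.complexConj F) 3 (Matrix.diagonal dV))
    (δ' : F) (r : ∀ μ : Literature.NumberTheory.Automorphic.IdeleClassGroup F →ₜ* Circle,
      IdeleClassGroup.IsConjugateSymplectic F μ → Rep ↥(maximalRealSubfield F) (imagUnitSq F)) :
    UniformOmega (sec42DataIdOf h isoOf F ι₁ V Φ) where
  Eps := (uniformOmegaRep h F ι₁ V Φ e dV hdV hdV0 ιV δ' r).Eps
  epsOf := (uniformOmegaRep h F ι₁ V Φ e dV hdV hdV0 ιV δ' r).epsOf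
  Chi := (uniformOmegaRep h F ι₁ V Φ e dV hdV hdV0 ιV δ' r).Chi
  omega := (uniformOmegaRep h F ι₁ V Φ e dV hdV hdV0 ιV δ' r).omega
  rho := (uniformOmegaRep h F ι₁ V Φ e dV hdV hdV0 ιV δ' r).rho

/-- `𝕌₁.Eps = 𝕌.Eps`. [cite: Liu2021, Def. 4.11 (ll. 2083–2097)] -/
theorem uniformOmegaRepId_Eps (h : exists_recordSystem) (F : CMField) [IsGalois ℚ F]
    (ι₁ : F →+* ℂ) (V : HermSpace3 F ι₁) (Φ : CMType F) {n : ℕ} (e : Fin 3 × Fin 1 ≃ Fin n) (dV : Fin 3 → F)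
    (hdV : ∀ i, IsCMField.complexConj F (dV i) = dV i) (hdV0 : ∀ i, dV i ≠ 0)
    (ιV : (sec42DataIdOf h isoOf F ι₁ V Φ).G →*
      UnitaryGroup.finAdelic ↥(maximalRealSubfield F) F (IsCMField.complexConj F) 3 (Matrix.diagonal dV))
    (δ' : F) (r : ∀ μ : Literature.NumberTheory.Automorphic.IdeleClassGroup F →ₜ* Circle,
      IdeleClassGroup.IsConjugateSymplectic F μ → Rep ↥(maximalRealSubfield F) (imagUnitSq F)) :
    (uniformOmegaRepId h F ι₁ V Φ e dV hdV hdV0 ιV δ' r).Eps = (uniformOmegaRep h F ι₁ V Φ e dV hdV hdV0 ιV δ' r).Eps := rfl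

/-- `𝕌₁.epsOf = 𝕌.epsOf`. [cite: Liu2021, Def. 4.12 (ll. 2102–2108)] -/
theorem uniformOmegaRepId_epsOf (h : exists_recordSystem) (F : CMField) [IsGalois ℚ F]
    (ι₁ : F →+* ℂ) (V : HermSpace3 F ι₁) (Φ : CMType F) {n : ℕ} (e : Fin 3 × Fin 1 ≃ Fin n) (dV : Fin 3 → F)
    (hdV : ∀ i, IsCMField.complexConj F (dV i) = dV i) (hdV0 : ∀ i, dV i ≠ 0)
    (ιV : (sec42DataIdOf h isoOf F ι₁ V Φ).G →*
      UnitaryGroup.finAdelic ↥(maximalRealSubfield F) F (IsCMField.complexConj F) 3 (Matrix.diagonal dV))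
    (δ' : F) (r : ∀ μ : Literature.NumberTheory.Automorphic.IdeleClassGroup F →ₜ* Circle,
      IdeleClassGroup.IsConjugateSymplectic F μ → Rep ↥(maximalRealSubfield F) (imagUnitSq F)) :
    (uniformOmegaRepId h F ι₁ V Φ e dV hdV hdV0 ιV δ' r).epsOf = (uniformOmegaRep h F ι₁ V Φ e dV hdV hdV0 ιV δ' r).epsOf := rfl

/-- `𝕌₁.Chi = 𝕌.Chi`. [cite: Liu2021, Def. 4.11 (ll. 2083–2097)] -/
theorem uniformOmegaRepId_Chi (h : exists_recordSystem) (F : CMField) [IsGalois ℚ F]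
    (ι₁ : F →+* ℂ) (V : HermSpace3 F ι₁) (Φ : CMType F) {n : ℕ} (e : Fin 3 × Fin 1 ≃ Fin n) (dV : Fin 3 → F)
    (hdV : ∀ i, IsCMField.complexConj F (dV i) = dV i) (hdV0 : ∀ i, dV i ≠ 0)
    (ιV : (sec42DataIdOf h isoOf F ι₁ V Φ).G →*
      UnitaryGroup.finAdelic ↥(maximalRealSubfield F) F (IsCMField.complexConj F) 3 (Matrix.diagonal dV))
    (δ' : F) (r : ∀ μ : Literature.NumberTheory.Automorphic.IdeleClassGroup F →ₜ* Circle,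
      IdeleClassGroup.IsConjugateSymplectic F μ → Rep ↥(maximalRealSubfield F) (imagUnitSq F)) :
    (uniformOmegaRepId h F ι₁ V Φ e dV hdV hdV0 ιV δ' r).Chi = (uniformOmegaRep h F ι₁ V Φ e dV hdV hdV0 ιV δ' r).Chi := rfl

/-- `𝕌₁.omega = 𝕌.omega` (every `ω(μ,ε,χ)` is the SAME type). [cite: Liu2021, Def. 4.11 (ll. 2083–2097)] -/
theorem uniformOmegaRepId_omega (h : exists_recordSystem) (F : CMField) [IsGalois ℚ F]
    (ι₁ : F →+* ℂ) (V : HermSpace3 F ι₁) (Φ : CMType F) {n : ℕ} (e : Fin 3 × Fin 1 ≃ Fin n) (dV : Fin 3 → F)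
    (hdV : ∀ i, IsCMField.complexConj F (dV i) = dV i) (hdV0 : ∀ i, dV i ≠ 0)
    (ιV : (sec42DataIdOf h isoOf F ι₁ V Φ).G →*
      UnitaryGroup.finAdelic ↥(maximalRealSubfield F) F (IsCMField.complexConj F) 3 (Matrix.diagonal dV))
    (δ' : F) (r : ∀ μ : Literature.NumberTheory.Automorphic.IdeleClassGroup F →ₜ* Circle,
      IdeleClassGroup.IsConjugateSymplectic F μ → Rep ↥(maximalRealSubfield F) (imagUnitSq F)) :
    (uniformOmegaRepId h F ι₁ V Φ e dV hdV hdV0 ιV δ' r).omega = (uniformOmegaRep h F ι₁ V Φ e dV hdV hdV0 ιV δ' r).omega := rfl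

/-- `𝕌₁.rho = 𝕌.rho` (the SAME action of `U(V)(𝔸_{F⁺,f})`; the two `C.G` are both `↥V.adelicFin` literally). [cite: Liu2021, Def. 4.11 (ll. 2083–2097)] -/
theorem uniformOmegaRepId_rho (h : exists_recordSystem) (F : CMField) [IsGalois ℚ F]
    (ι₁ : F →+* ℂ) (V : HermSpace3 F ι₁) (Φ : CMType F) {n : ℕ} (e : Fin 3 × Fin 1 ≃ Fin n) (dV : Fin 3 → F)
    (hdV : ∀ i, IsCMField.complexConj F (dV i) = dV i) (hdV0 : ∀ i, dV i ≠ 0)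
    (ιV : (sec42DataIdOf h isoOf F ι₁ V Φ).G →*
      UnitaryGroup.finAdelic ↥(maximalRealSubfield F) F (IsCMField.complexConj F) 3 (Matrix.diagonal dV))
    (δ' : F) (r : ∀ μ : Literature.NumberTheory.Automorphic.IdeleClassGroup F →ₜ* Circle,
      IdeleClassGroup.IsConjugateSymplectic F μ → Rep ↥(maximalRealSubfield F) (imagUnitSq F)) :
    (uniformOmegaRepId h F ι₁ V Φ e dV hdV hdV0 ιV δ' r).rho = (uniformOmegaRep h F ι₁ V Φ e dV hdV hdV0 ιV δ' r).rho := rfl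

/-! ## §2 The pay-off: every Ω-side TYPE at `(ℭ₁, 𝕌₁, any tail)` IS the type at `(ℭ, 𝕌, any tail)` -/

/-- **[Liu2021, Prop. 4.13]'s datum is the SAME at `𝕌₁` and `𝕌`**: `𝕌₁.prop413Data H = 𝕌.prop413Data H` (`rfl`) — so the displayed cite
`h413 : Prop413AsPrinted (𝕌₁.prop413Data H)`, Def. 4.11's adjectives `h411` and the separation `hsep` over it are LITERALLY edition 1∕2's propositions.
[cite: Liu2021, Prop. 4.13 (ll. 2113–2119)] -/
theorem prop413Data_uniformOmegaRepId_eq (h : exists_recordSystem) (F : CMField) [IsGalois ℚ F]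
    (ι₁ : F →+* ℂ) (V : HermSpace3 F ι₁) (Φ : CMType F) {n : ℕ} (e : Fin 3 × Fin 1 ≃ Fin n) (dV : Fin 3 → F)
    (hdV : ∀ i, IsCMField.complexConj F (dV i) = dV i) (hdV0 : ∀ i, dV i ≠ 0)
    (ιV : (sec42DataIdOf h isoOf F ι₁ V Φ).G →*
      UnitaryGroup.finAdelic ↥(maximalRealSubfield F) F (IsCMField.complexConj F) 3 (Matrix.diagonal dV))
    (δ' : F) (r : ∀ μ : Literature.NumberTheory.Automorphic.IdeleClassGroup F →ₜ* Circle,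
      IdeleClassGroup.IsConjugateSymplectic F μ → Rep ↥(maximalRealSubfield F) (imagUnitSq F))
    (H : Type) [AddCommGroup H] [Module ℂ H] [Module (MonoidAlgebra ℂ ↥V.adelicFin) H]
    [IsScalarTower ℂ (MonoidAlgebra ℂ ↥V.adelicFin) H] :
    (uniformOmegaRepId h F ι₁ V Φ e dV hdV hdV0 ιV δ' r).prop413Data H = (uniformOmegaRep h F ι₁ V Φ e dV hdV hdV0 ιV δ' r).prop413Data H :=
  rfl

/-- The rests at `𝕌₁` and `𝕌` have the SAME CM type `Φ_μ` (`rfl`). [cite: Liu2021, Def. 4.3, Def. 4.16] -/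
theorem cmType_rest_uniformOmegaRepId_eq (h : exists_recordSystem) (F : CMField) [IsGalois ℚ F]
    (ι₁ : F →+* ℂ) (V : HermSpace3 F ι₁) (Φ : CMType F) {n : ℕ} (e : Fin 3 × Fin 1 ≃ Fin n) (dV : Fin 3 → F)
    (hdV : ∀ i, IsCMField.complexConj F (dV i) = dV i) (hdV0 : ∀ i, dV i ≠ 0)
    (ιV : (sec42DataIdOf h isoOf F ι₁ V Φ).G →*
      UnitaryGroup.finAdelic ↥(maximalRealSubfield F) F (IsCMField.complexConj F) 3 (Matrix.diagonal dV))
    (δ' : F) (r : ∀ μ : Literature.NumberTheory.Automorphic.IdeleClassGroup F →ₜ* Circle,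
      IdeleClassGroup.IsConjugateSymplectic F μ → Rep ↥(maximalRealSubfield F) (imagUnitSq F))
    {μ : Literature.NumberTheory.Automorphic.IdeleClassGroup F →ₜ* Circle} {hμ : IdeleClassGroup.IsConjugateSymplectic F μ}
    (t₁ : RestTail (sec42DataIdOf h isoOf F ι₁ V Φ) μ hμ) (t : RestTail (sec42DataOf h isoOf F ι₁ V Φ) μ hμ) :
    (toThm418Data (sec42DataIdOf h isoOf F ι₁ V Φ) ((uniformOmegaRepId h F ι₁ V Φ e dV hdV hdV0 ιV δ' r).rest t₁)).cmType =
      (toThm418Data (sec42DataOf h isoOf F ι₁ V Φ) ((uniformOmegaRep h F ι₁ V Φ e dV hdV hdV0 ιV δ' r).rest t)).cmType :=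
  rfl

/-- **THE «R-a» TEST (census §E), PASSED: the admissible INDEX TYPES agree** — `(toThm418Data ℭ₁ (𝕌₁.rest t₁)).AdmIndex = (toThm418Data ℭ (𝕌.rest t)).AdmIndex`
for ANY two tails at the same `(μ, hμ)` (`rfl`: `AdmIndex` reads `Eps ∕ Chi ∕ epsOf ∕ cmType` only). [cite: Liu2021, Def. 4.11, Def. 4.12] -/
theorem admIndex_rest_uniformOmegaRepId_eq (h : exists_recordSystem) (F : CMField) [IsGalois ℚ F]
    (ι₁ : F →+* ℂ) (V : HermSpace3 F ι₁) (Φ : CMType F) {n : ℕ} (e : Fin 3 × Fin 1 ≃ Fin n) (dV : Fin 3 → F)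
    (hdV : ∀ i, IsCMField.complexConj F (dV i) = dV i) (hdV0 : ∀ i, dV i ≠ 0)
    (ιV : (sec42DataIdOf h isoOf F ι₁ V Φ).G →*
      UnitaryGroup.finAdelic ↥(maximalRealSubfield F) F (IsCMField.complexConj F) 3 (Matrix.diagonal dV))
    (δ' : F) (r : ∀ μ : Literature.NumberTheory.Automorphic.IdeleClassGroup F →ₜ* Circle,
      IdeleClassGroup.IsConjugateSymplectic F μ → Rep ↥(maximalRealSubfield F) (imagUnitSq F))
    {μ : Literature.NumberTheory.Automorphic.IdeleClassGroup F →ₜ* Circle} {hμ : IdeleClassGroup.IsConjugateSymplectic F μ}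
    (t₁ : RestTail (sec42DataIdOf h isoOf F ι₁ V Φ) μ hμ) (t : RestTail (sec42DataOf h isoOf F ι₁ V Φ) μ hμ) :
    (toThm418Data (sec42DataIdOf h isoOf F ι₁ V Φ) ((uniformOmegaRepId h F ι₁ V Φ e dV hdV hdV0 ιV δ' r).rest t₁)).AdmIndex =
      (toThm418Data (sec42DataOf h isoOf F ι₁ V Φ) ((uniformOmegaRep h F ι₁ V Φ e dV hdV hdV0 ιV δ' r).rest t)).AdmIndex :=
  rfl

/-- … and so do the WEIL MODULES at every admissible index: `ω_i` at `(ℭ₁, 𝕌₁, t₁)` IS `ω_i` at `(ℭ, 𝕌, t)` (`rfl`; the index `i` is read at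
both types through `admIndex_rest_uniformOmegaRepId_eq`, definitionally). [cite: Liu2021, Def. 4.11 (ll. 2083–2097)] -/
theorem omegaAt_rest_uniformOmegaRepId_eq (h : exists_recordSystem) (F : CMField) [IsGalois ℚ F]
    (ι₁ : F →+* ℂ) (V : HermSpace3 F ι₁) (Φ : CMType F) {n : ℕ} (e : Fin 3 × Fin 1 ≃ Fin n) (dV : Fin 3 → F)
    (hdV : ∀ i, IsCMField.complexConj F (dV i) = dV i) (hdV0 : ∀ i, dV i ≠ 0)
    (ιV : (sec42DataIdOf h isoOf F ι₁ V Φ).G →*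
      UnitaryGroup.finAdelic ↥(maximalRealSubfield F) F (IsCMField.complexConj F) 3 (Matrix.diagonal dV))
    (δ' : F) (r : ∀ μ : Literature.NumberTheory.Automorphic.IdeleClassGroup F →ₜ* Circle,
      IdeleClassGroup.IsConjugateSymplectic F μ → Rep ↥(maximalRealSubfield F) (imagUnitSq F))
    {μ : Literature.NumberTheory.Automorphic.IdeleClassGroup F →ₜ* Circle} {hμ : IdeleClassGroup.IsConjugateSymplectic F μ}
    (t₁ : RestTail (sec42DataIdOf h isoOf F ι₁ V Φ) μ hμ) (t : RestTail (sec42DataOf h isoOf F ι₁ V Φ) μ hμ)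
    (i : (toThm418Data (sec42DataIdOf h isoOf F ι₁ V Φ) ((uniformOmegaRepId h F ι₁ V Φ e dV hdV hdV0 ιV δ' r).rest t₁)).AdmIndex) :
    (toThm418Data (sec42DataIdOf h isoOf F ι₁ V Φ) ((uniformOmegaRepId h F ι₁ V Φ e dV hdV hdV0 ιV δ' r).rest t₁)).omegaAt i =
      (toThm418Data (sec42DataOf h isoOf F ι₁ V Φ) ((uniformOmegaRep h F ι₁ V Φ e dV hdV hdV0 ιV δ' r).rest t)).omegaAt i :=
  rfl

/-- … with the SAME `𝔾(𝔸_F^∞)`-action (`rfl`). [cite: Liu2021, Def. 4.11 (ll. 2083–2097)] -/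
theorem rhoAt_rest_uniformOmegaRepId_eq (h : exists_recordSystem) (F : CMField) [IsGalois ℚ F]
    (ι₁ : F →+* ℂ) (V : HermSpace3 F ι₁) (Φ : CMType F) {n : ℕ} (e : Fin 3 × Fin 1 ≃ Fin n) (dV : Fin 3 → F)
    (hdV : ∀ i, IsCMField.complexConj F (dV i) = dV i) (hdV0 : ∀ i, dV i ≠ 0)
    (ιV : (sec42DataIdOf h isoOf F ι₁ V Φ).G →*
      UnitaryGroup.finAdelic ↥(maximalRealSubfield F) F (IsCMField.complexConj F) 3 (Matrix.diagonal dV))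
    (δ' : F) (r : ∀ μ : Literature.NumberTheory.Automorphic.IdeleClassGroup F →ₜ* Circle,
      IdeleClassGroup.IsConjugateSymplectic F μ → Rep ↥(maximalRealSubfield F) (imagUnitSq F))
    {μ : Literature.NumberTheory.Automorphic.IdeleClassGroup F →ₜ* Circle} {hμ : IdeleClassGroup.IsConjugateSymplectic F μ}
    (t₁ : RestTail (sec42DataIdOf h isoOf F ι₁ V Φ) μ hμ) (t : RestTail (sec42DataOf h isoOf F ι₁ V Φ) μ hμ)
    (i : (toThm418Data (sec42DataIdOf h isoOf F ι₁ V Φ) ((uniformOmegaRepId h F ι₁ V Φ e dV hdV hdV0 ιV δ' r).rest t₁)).AdmIndex) :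
    (toThm418Data (sec42DataIdOf h isoOf F ι₁ V Φ) ((uniformOmegaRepId h F ι₁ V Φ e dV hdV hdV0 ιV δ' r).rest t₁)).rhoAt i =
      (toThm418Data (sec42DataOf h isoOf F ι₁ V Φ) ((uniformOmegaRep h F ι₁ V Φ e dV hdV hdV0 ιV δ' r).rest t)).rhoAt i :=
  rfl

/-- The group is the same literal type `U(V)(𝔸_{F⁺,f})` on both sides (`rfl`). [cite: Liu2021, §4.2 l. 2060] -/
theorem G_rest_uniformOmegaRepId_eq (h : exists_recordSystem) (F : CMField) [IsGalois ℚ F]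
    (ι₁ : F →+* ℂ) (V : HermSpace3 F ι₁) (Φ : CMType F) {n : ℕ} (e : Fin 3 × Fin 1 ≃ Fin n) (dV : Fin 3 → F)
    (hdV : ∀ i, IsCMField.complexConj F (dV i) = dV i) (hdV0 : ∀ i, dV i ≠ 0)
    (ιV : (sec42DataIdOf h isoOf F ι₁ V Φ).G →*
      UnitaryGroup.finAdelic ↥(maximalRealSubfield F) F (IsCMField.complexConj F) 3 (Matrix.diagonal dV))
    (δ' : F) (r : ∀ μ : Literature.NumberTheory.Automorphic.IdeleClassGroup F →ₜ* Circle,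
      IdeleClassGroup.IsConjugateSymplectic F μ → Rep ↥(maximalRealSubfield F) (imagUnitSq F))
    {μ : Literature.NumberTheory.Automorphic.IdeleClassGroup F →ₜ* Circle} {hμ : IdeleClassGroup.IsConjugateSymplectic F μ}
    (t₁ : RestTail (sec42DataIdOf h isoOf F ι₁ V Φ) μ hμ) (t : RestTail (sec42DataOf h isoOf F ι₁ V Φ) μ hμ) :
    (toThm418Data (sec42DataIdOf h isoOf F ι₁ V Φ) ((uniformOmegaRepId h F ι₁ V Φ e dV hdV hdV0 ιV δ' r).rest t₁)).G =
      (toThm418Data (sec42DataOf h isoOf F ι₁ V Φ) ((uniformOmegaRep h F ι₁ V Φ e dV hdV hdV0 ιV δ' r).rest t)).G :=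
  rfl

/-! ## §3 TRANSPORT TOOLS for the consumers (I9 Ω-pin, I10 §A, I11 `eR₁`, I8)

KERNEL-COST RULE (desk probes `T1probe`∕`T2probe`, HOME∕INBOX 23:43Z): at the CONCRETE δ′-tails `𝔱₁`∕`𝔱` the bare definitional unfolding of
`(ℭ₁, 𝕌₁, 𝔱₁)`- against `(ℭ, 𝕌, 𝔱)`-typed terms exhausts the kernel («excessive memory consumption»), while every comparison through the
§2 lemmas — stated for ARBITRARY tails, hence `rfl` on small terms — is cheap.  The tools below do ALL the definitional work once, at generic
tails; consumers INSTANTIATE them at `𝔱₁ ∕ 𝔱` (instantiation costs nothing) and never unfold. -/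

/-- Reading a LIVE admissible index at the Id datum: `cast` along `admIndex_rest_uniformOmegaRepId_eq` (at generic tails this is the identity). -/
theorem omegaAt_cast_admIndex_uniformOmegaRepId_eq (h : exists_recordSystem) (F : CMField) [IsGalois ℚ F]
    (ι₁ : F →+* ℂ) (V : HermSpace3 F ι₁) (Φ : CMType F) {n : ℕ} (e : Fin 3 × Fin 1 ≃ Fin n) (dV : Fin 3 → F)
    (hdV : ∀ i, IsCMField.complexConj F (dV i) = dV i) (hdV0 : ∀ i, dV i ≠ 0)
    (ιV : (sec42DataIdOf h isoOf F ι₁ V Φ).G →*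
      UnitaryGroup.finAdelic ↥(maximalRealSubfield F) F (IsCMField.complexConj F) 3 (Matrix.diagonal dV))
    (δ' : F) (r : ∀ μ : Literature.NumberTheory.Automorphic.IdeleClassGroup F →ₜ* Circle,
      IdeleClassGroup.IsConjugateSymplectic F μ → Rep ↥(maximalRealSubfield F) (imagUnitSq F))
    {μ : Literature.NumberTheory.Automorphic.IdeleClassGroup F →ₜ* Circle} {hμ : IdeleClassGroup.IsConjugateSymplectic F μ}
    (t₁ : RestTail (sec42DataIdOf h isoOf F ι₁ V Φ) μ hμ) (t : RestTail (sec42DataOf h isoOf F ι₁ V Φ) μ hμ) (j : (toThm418Data (sec42DataOf h isoOf F ι₁ V Φ) ((uniformOmegaRep h F ι₁ V Φ e dV hdV hdV0 ιV δ' r).rest t)).AdmIndex) :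
    (toThm418Data (sec42DataIdOf h isoOf F ι₁ V Φ) ((uniformOmegaRepId h F ι₁ V Φ e dV hdV hdV0 ιV δ' r).rest t₁)).omegaAt (cast (admIndex_rest_uniformOmegaRepId_eq h F ι₁ V Φ e dV hdV hdV0 ιV δ' r t₁ t).symm j) = (toThm418Data (sec42DataOf h isoOf F ι₁ V Φ) ((uniformOmegaRep h F ι₁ V Φ e dV hdV hdV0 ιV δ' r).rest t)).omegaAt j :=
  rfl

/-- … with the same action. -/
theorem rhoAt_cast_admIndex_uniformOmegaRepId_eq (h : exists_recordSystem) (F : CMField) [IsGalois ℚ F]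
    (ι₁ : F →+* ℂ) (V : HermSpace3 F ι₁) (Φ : CMType F) {n : ℕ} (e : Fin 3 × Fin 1 ≃ Fin n) (dV : Fin 3 → F)
    (hdV : ∀ i, IsCMField.complexConj F (dV i) = dV i) (hdV0 : ∀ i, dV i ≠ 0)
    (ιV : (sec42DataIdOf h isoOf F ι₁ V Φ).G →*
      UnitaryGroup.finAdelic ↥(maximalRealSubfield F) F (IsCMField.complexConj F) 3 (Matrix.diagonal dV))
    (δ' : F) (r : ∀ μ : Literature.NumberTheory.Automorphic.IdeleClassGroup F →ₜ* Circle,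
      IdeleClassGroup.IsConjugateSymplectic F μ → Rep ↥(maximalRealSubfield F) (imagUnitSq F))
    {μ : Literature.NumberTheory.Automorphic.IdeleClassGroup F →ₜ* Circle} {hμ : IdeleClassGroup.IsConjugateSymplectic F μ}
    (t₁ : RestTail (sec42DataIdOf h isoOf F ι₁ V Φ) μ hμ) (t : RestTail (sec42DataOf h isoOf F ι₁ V Φ) μ hμ) (j : (toThm418Data (sec42DataOf h isoOf F ι₁ V Φ) ((uniformOmegaRep h F ι₁ V Φ e dV hdV hdV0 ιV δ' r).rest t)).AdmIndex) :
    (toThm418Data (sec42DataIdOf h isoOf F ι₁ V Φ) ((uniformOmegaRepId h F ι₁ V Φ e dV hdV hdV0 ιV δ' r).rest t₁)).rhoAt (cast (admIndex_rest_uniformOmegaRepId_eq h F ι₁ V Φ e dV hdV hdV0 ιV δ' r t₁ t).symm j) = (toThm418Data (sec42DataOf h isoOf F ι₁ V Φ) ((uniformOmegaRep h F ι₁ V Φ e dV hdV hdV0 ιV δ' r).rest t)).rhoAt j :=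
  rfl

/-- `cast` along `admIndex_rest_uniformOmegaRepId_eq` is injective (it is a bijection between EQUAL types). -/
theorem cast_admIndex_uniformOmegaRepId_injective (h : exists_recordSystem) (F : CMField) [IsGalois ℚ F]
    (ι₁ : F →+* ℂ) (V : HermSpace3 F ι₁) (Φ : CMType F) {n : ℕ} (e : Fin 3 × Fin 1 ≃ Fin n) (dV : Fin 3 → F)
    (hdV : ∀ i, IsCMField.complexConj F (dV i) = dV i) (hdV0 : ∀ i, dV i ≠ 0)
    (ιV : (sec42DataIdOf h isoOf F ι₁ V Φ).G →*
      UnitaryGroup.finAdelic ↥(maximalRealSubfield F) F (IsCMField.complexConj F) 3 (Matrix.diagonal dV))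
    (δ' : F) (r : ∀ μ : Literature.NumberTheory.Automorphic.IdeleClassGroup F →ₜ* Circle,
      IdeleClassGroup.IsConjugateSymplectic F μ → Rep ↥(maximalRealSubfield F) (imagUnitSq F))
    {μ : Literature.NumberTheory.Automorphic.IdeleClassGroup F →ₜ* Circle} {hμ : IdeleClassGroup.IsConjugateSymplectic F μ}
    (t₁ : RestTail (sec42DataIdOf h isoOf F ι₁ V Φ) μ hμ) (t : RestTail (sec42DataOf h isoOf F ι₁ V Φ) μ hμ) :
    Function.Injective (fun j : (toThm418Data (sec42DataOf h isoOf F ι₁ V Φ) ((uniformOmegaRep h F ι₁ V Φ e dV hdV hdV0 ιV δ' r).rest t)).AdmIndex => cast (admIndex_rest_uniformOmegaRepId_eq h F ι₁ V Φ e dV hdV hdV0 ιV δ' r t₁ t).symm j) :=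
  fun _ _ hab => (cast_inj (admIndex_rest_uniformOmegaRepId_eq h F ι₁ V Φ e dV hdV hdV0 ιV δ' r t₁ t).symm).1 hab

/-- **(b) Ω-PIN TRANSPORT.**  An Ω-pin datum at the LIVE rest `𝕌.rest t` — an index map `σ : χ → AdmIndex`, `ℂ`-linear identifications
`e a : M a ≃ₗ[ℂ] ω_{σ a}`, injectivity of `σ`, equivariance of `e` for a given action `sm` of `U(V)(𝔸_{F⁺,f})` on the `M a` — IS an Ω-pin
datum at the Id rest `𝕌₁.rest t₁` (same `χ`, same `M`, same `sm`).  Proved at generic tails by the identity; I9 instantiates it at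
`(t₁, t) := (𝔱₁, 𝔱)` on the conclusion of ✔ `OmegaPin.exists_pinTerms_indexOfRecord`. [cite: Liu2021, Def. 4.11 (ll. 2083–2097), Thm. 4.18] -/
theorem exists_omegaPin_transport_uniformOmegaRepId (h : exists_recordSystem) (F : CMField) [IsGalois ℚ F]
    (ι₁ : F →+* ℂ) (V : HermSpace3 F ι₁) (Φ : CMType F) {n : ℕ} (e : Fin 3 × Fin 1 ≃ Fin n) (dV : Fin 3 → F)
    (hdV : ∀ i, IsCMField.complexConj F (dV i) = dV i) (hdV0 : ∀ i, dV i ≠ 0)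
    (ιV : (sec42DataIdOf h isoOf F ι₁ V Φ).G →*
      UnitaryGroup.finAdelic ↥(maximalRealSubfield F) F (IsCMField.complexConj F) 3 (Matrix.diagonal dV))
    (δ' : F) (r : ∀ μ : Literature.NumberTheory.Automorphic.IdeleClassGroup F →ₜ* Circle,
      IdeleClassGroup.IsConjugateSymplectic F μ → Rep ↥(maximalRealSubfield F) (imagUnitSq F))
    {μ : Literature.NumberTheory.Automorphic.IdeleClassGroup F →ₜ* Circle} {hμ : IdeleClassGroup.IsConjugateSymplectic F μ}
    (t₁ : RestTail (sec42DataIdOf h isoOf F ι₁ V Φ) μ hμ) (t : RestTail (sec42DataOf h isoOf F ι₁ V Φ) μ hμ) {χ : Type} {M : χ → Type} [∀ a, AddCommGroup (M a)] [∀ a, Module ℂ (M a)]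
    (sm : ∀ a, ↥V.adelicFin → M a → M a)
    (σ : χ → (toThm418Data (sec42DataOf h isoOf F ι₁ V Φ) ((uniformOmegaRep h F ι₁ V Φ e dV hdV hdV0 ιV δ' r).rest t)).AdmIndex) (eσ : ∀ a, M a ≃ₗ[ℂ] (toThm418Data (sec42DataOf h isoOf F ι₁ V Φ) ((uniformOmegaRep h F ι₁ V Φ e dV hdV hdV0 ιV δ' r).rest t)).omegaAt (σ a))
    (hσ : Function.Injective σ)
    (heσ : ∀ (a : χ) (g : ↥V.adelicFin) (m : M a), eσ a (sm a g m) = (toThm418Data (sec42DataOf h isoOf F ι₁ V Φ) ((uniformOmegaRep h F ι₁ V Φ e dV hdV hdV0 ιV δ' r).rest t)).rhoAt (σ a) g (eσ a m)) :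
    ∃ (σ₁ : χ → (toThm418Data (sec42DataIdOf h isoOf F ι₁ V Φ) ((uniformOmegaRepId h F ι₁ V Φ e dV hdV hdV0 ιV δ' r).rest t₁)).AdmIndex) (e₁ : ∀ a, M a ≃ₗ[ℂ] (toThm418Data (sec42DataIdOf h isoOf F ι₁ V Φ) ((uniformOmegaRepId h F ι₁ V Φ e dV hdV hdV0 ιV δ' r).rest t₁)).omegaAt (σ₁ a)),
      Function.Injective σ₁ ∧
      ∀ (a : χ) (g : ↥V.adelicFin) (m : M a), e₁ a (sm a g m) = (toThm418Data (sec42DataIdOf h isoOf F ι₁ V Φ) ((uniformOmegaRepId h F ι₁ V Φ e dV hdV hdV0 ιV δ' r).rest t₁)).rhoAt (σ₁ a) g (e₁ a m) :=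
  ⟨σ, eσ, hσ, heσ⟩

/-- **(b′) NON-VANISHING TRANSPORT**: `Nontrivial ω_j` for every live index ⟹ for every Id index ([Liu2021] Lem. D.1 (1) at the pin). -/
theorem nontrivial_omegaAt_transport_uniformOmegaRepId (h : exists_recordSystem) (F : CMField) [IsGalois ℚ F]
    (ι₁ : F →+* ℂ) (V : HermSpace3 F ι₁) (Φ : CMType F) {n : ℕ} (e : Fin 3 × Fin 1 ≃ Fin n) (dV : Fin 3 → F)
    (hdV : ∀ i, IsCMField.complexConj F (dV i) = dV i) (hdV0 : ∀ i, dV i ≠ 0)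
    (ιV : (sec42DataIdOf h isoOf F ι₁ V Φ).G →*
      UnitaryGroup.finAdelic ↥(maximalRealSubfield F) F (IsCMField.complexConj F) 3 (Matrix.diagonal dV))
    (δ' : F) (r : ∀ μ : Literature.NumberTheory.Automorphic.IdeleClassGroup F →ₜ* Circle,
      IdeleClassGroup.IsConjugateSymplectic F μ → Rep ↥(maximalRealSubfield F) (imagUnitSq F))
    {μ : Literature.NumberTheory.Automorphic.IdeleClassGroup F →ₜ* Circle} {hμ : IdeleClassGroup.IsConjugateSymplectic F μ}
    (t₁ : RestTail (sec42DataIdOf h isoOf F ι₁ V Φ) μ hμ) (t : RestTail (sec42DataOf h isoOf F ι₁ V Φ) μ hμ) (hnv : ∀ j : (toThm418Data (sec42DataOf h isoOf F ι₁ V Φ) ((uniformOmegaRep h F ι₁ V Φ e dV hdV hdV0 ιV δ' r).rest t)).AdmIndex, Nontrivial ((toThm418Data (sec42DataOf h isoOf F ι₁ V Φ) ((uniformOmegaRep h F ι₁ V Φ e dV hdV hdV0 ιV δ' r).rest t)).omegaAt j))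
    (j₁ : (toThm418Data (sec42DataIdOf h isoOf F ι₁ V Φ) ((uniformOmegaRepId h F ι₁ V Φ e dV hdV hdV0 ιV δ' r).rest t₁)).AdmIndex) : Nontrivial ((toThm418Data (sec42DataIdOf h isoOf F ι₁ V Φ) ((uniformOmegaRepId h F ι₁ V Φ e dV hdV hdV0 ιV δ' r).rest t₁)).omegaAt j₁) :=
  hnv j₁

/-- **MULTIPLICITY TRANSPORT**: a bound on `dim Hom_{ℂ[𝔾]}(ω_j, H)` at every live index is the same bound at every Id index. -/
theorem rank_intertwiningMap_transport_uniformOmegaRepId (h : exists_recordSystem) (F : CMField) [IsGalois ℚ F]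
    (ι₁ : F →+* ℂ) (V : HermSpace3 F ι₁) (Φ : CMType F) {n : ℕ} (e : Fin 3 × Fin 1 ≃ Fin n) (dV : Fin 3 → F)
    (hdV : ∀ i, IsCMField.complexConj F (dV i) = dV i) (hdV0 : ∀ i, dV i ≠ 0)
    (ιV : (sec42DataIdOf h isoOf F ι₁ V Φ).G →*
      UnitaryGroup.finAdelic ↥(maximalRealSubfield F) F (IsCMField.complexConj F) 3 (Matrix.diagonal dV))
    (δ' : F) (r : ∀ μ : Literature.NumberTheory.Automorphic.IdeleClassGroup F →ₜ* Circle,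
      IdeleClassGroup.IsConjugateSymplectic F μ → Rep ↥(maximalRealSubfield F) (imagUnitSq F))
    {μ : Literature.NumberTheory.Automorphic.IdeleClassGroup F →ₜ* Circle} {hμ : IdeleClassGroup.IsConjugateSymplectic F μ}
    (t₁ : RestTail (sec42DataIdOf h isoOf F ι₁ V Φ) μ hμ) (t : RestTail (sec42DataOf h isoOf F ι₁ V Φ) μ hμ) (H : Type) [AddCommGroup H] [Module ℂ H] [Module (MonoidAlgebra ℂ ↥V.adelicFin) H]
    [IsScalarTower ℂ (MonoidAlgebra ℂ ↥V.adelicFin) H] (b : Cardinal)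
    (hm : ∀ j : (toThm418Data (sec42DataOf h isoOf F ι₁ V Φ) ((uniformOmegaRep h F ι₁ V Φ e dV hdV hdV0 ιV δ' r).rest t)).AdmIndex, Module.rank ℂ (Representation.IntertwiningMap ((toThm418Data (sec42DataOf h isoOf F ι₁ V Φ) ((uniformOmegaRep h F ι₁ V Φ e dV hdV hdV0 ιV δ' r).rest t)).rhoAt j)
      (Representation.ofModule' (k := ℂ) (G := ↥V.adelicFin) H)) ≤ b)
    (j₁ : (toThm418Data (sec42DataIdOf h isoOf F ι₁ V Φ) ((uniformOmegaRepId h F ι₁ V Φ e dV hdV hdV0 ιV δ' r).rest t₁)).AdmIndex) :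
    Module.rank ℂ (Representation.IntertwiningMap ((toThm418Data (sec42DataIdOf h isoOf F ι₁ V Φ) ((uniformOmegaRepId h F ι₁ V Φ e dV hdV hdV0 ιV δ' r).rest t₁)).rhoAt j₁) (Representation.ofModule' (k := ℂ) (G := ↥V.adelicFin) H)) ≤ b :=
  hm j₁

end Frame

end Summit.HodgeConjecture.CorCM.Model

end
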